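import Summits.NavierStokesRegularity.FluidComputer.GateBudgetSwingPulse
import Summits.NavierStokesRegularity.FluidComputer.GateBudgetRungTwoSided
import HarnessLib

/-!
# GateBudget part 106 — the swing transfer, VI: the two-sided rung at `k = 1` (§288)

Cell `pub-fluidc`, blueprint seat bp1 (gen 39); namespace
`Summit.NavierStokesRegularity.FluidComputer.GateBudget`, headline family
`RotorKnob.rotorCircuit K K¹⁰ ε ρ` from `delayInit` (`K ≥ 16`) on the UNIT lattice
`ε = K¹⁰ρ²`. HONEST FRAMING: a low prior, high value-of-information experiment on Tao's
machine paradigm; NOT a claim that NS blows up. Nothing here is about the Navier–Stokes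
equations: these are inequalities about the five-mode toy circuit (5.5)/(5.6).

* §288a `unit_lattice_numerics` — the unit lattice `ε = K¹⁰ρ²` sits in the lattice window of
  parts 65–90 (`200ε/K²⁰ ≤ ρ² `, `K¹⁰ρ² ≤ 2ε`, `ε = 1·K¹⁰ρ²`, `ρ² ≤ ε`), and the part-52 pin
  radius at `k = 1`, `δ₀ = π/((25/16 - 10⁻⁶)K¹⁰ - 1) + 1/K¹⁹`, obeys `0 ≤ δ₀ ≤ 4/K¹⁰` and
  `1500δ₀² log K ≤ 1/12`.
* §288b `knob_pulse_ceiling_swing_pin` — THE SWING-PRICED CEILING AT THE PIN (glue). Part 105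
  §287 with its three side conditions discharged from data every pulse of the ladder already
  carries: the kept ring (part 53 `knob_radius_kept_free` from the entry radius `≤ 4ε²`),
  `a(r) ≠ 0` (the sphere `Σ xᵢ² = 1` minus `b² + c² ≤ 10⁻⁶` minus `P(r) = d² + ã² ≤ 1/50`),
  and the exit phase at the part-52 pin `δ₀` (absorbed: `1/4 + 1500δ₀² log K ≤ 1/3`):
  `ã(T') ≤ ã(r) + (1.57a(r)² + 3.33(|d(r)| + d(r)²) + 1/3 + 520 log K·d(r)²)/K⁹`.
* §288c `knob_pulse_ceiling_swing_ladder` — the same in the shape the ladder step of part 97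
  consumes (exit clock `θ - 242 log K/K¹⁰ ≤ θ₁` of part 90, `|d(r)| ≤ D`, `a(r)² ≤ 1`):
  `ã(T') ≤ ã(r) + U/K⁹` whenever `1.57 + 1/3 + 3.33(D + D²) + 520 log K·D² ≤ U`.
* §288 `knob_rung_swing` — THE TWO-SIDED RUNG AT `k = 1` WITH THE SWING PRICE: part 76 §227
  on the unit lattice with the ceiling of §288b,
  `ã(r) + 1/K⁹ ≤ ã(T') ≤ ã(r) + (1.57a(r)² + 3.33(|d(r)| + d(r)²) + 1/3 + 520 log K·d(r)²)/K⁹`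
  against part 76's `ã(T') ≤ ã(r) + (7/2 + 1/3 + 520 log K·d(r)²)/K⁹` (at `k = 1`). The floor
  half is part 76's proof verbatim (part 65 fine pulse, part 52 pin, part 71 §217 leak law).

WHAT THIS SAYS (and does not). Per rung of the `k = 1` ladder the output climbs at least
`1/K⁹` and at most `U₁/K⁹`, `U₁ = 1.57 + 1/3 + 3.33(D + D²) + 520 log K·D² < 2` for the
ladder's drift bound `D = O(K⁻⁵)`, against `U = 23/6 + 10⁻³` in parts 97/98; the dud horizon
of part 98 re-run with `U = 2` (`≈ 0.0657K⁹` at `K = 16` against today's `0.0343K⁹`;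
necessity ceiling `0.1415K⁹ + 1`) is parts 107/108, NOT this file, and a FORECAST until
filed. HONEST LIMITS: (i) `k = 1` only; (ii) the constants `1.57`, `3.33`, `1/3`, `520` carry
the slack of parts 75/105 (the truth is `≈ 2cos α₁ · a(r)²/θ ≤ 1.56` per rung plus `O(D)`);
(iii) no matching phase-resolved floor; (iv) nothing about NS.
[cite: Tao2016AveragedNS, §5.5 Theorem 5.3, (5.5), (b-eq), (c-eq), (d-eq), (ta-eq),
(energy-con)]
-/

noncomputable section

namespace Summit.NavierStokesRegularity.FluidComputer.GateBudget

open Real Set Filter Topology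
open Literature.Analysis.FluidPDE.Tao2016AveragedNS

variable {K ε ρ : ℝ} {X : ℝ → Fin 5 → ℝ} {C : ℝ → ℝ}

/-! ## §288a Numerics of the unit lattice -/

/-- §288a NUMERICS OF THE UNIT LATTICE (`K ≥ 16`, `ε = K¹⁰ρ²`): the lattice window of parts
65–90 (`200ε/K²⁰ ≤ ρ²`, `K¹⁰ρ² ≤ 2ε`), `ε = 1·K¹⁰ρ²`, `ρ² ≤ ε`, and for the part-52 pin
radius `δ₀ = π/((25/16 - 10⁻⁶)K¹⁰ - 1) + 1/K¹⁹` at `k = 1`: `0 ≤ δ₀ ≤ 4/K¹⁰` and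
`1500δ₀² log K ≤ 1/12` (`log K ≤ K`, `K¹⁹ ≥ 16¹⁹`).
[derived: arithmetic] -/
theorem unit_lattice_numerics (hK : 16 ≤ K) (hlat : ε = K ^ 10 * ρ ^ 2) :
    200 * ε / K ^ 20 ≤ ρ ^ 2 ∧ K ^ 10 * ρ ^ 2 ≤ 2 * ε ∧ ε = ((1 : ℕ) : ℝ) * K ^ 10 * ρ ^ 2 ∧
      ρ ^ 2 ≤ ε ∧ 0 ≤ π / ((25 / 16 - 1 / 10 ^ 6) * K ^ 10 - 1) + 1 / K ^ 19 ∧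
      π / ((25 / 16 - 1 / 10 ^ 6) * K ^ 10 - 1) + 1 / K ^ 19 ≤ 4 / K ^ 10 ∧
      1500 * (π / ((25 / 16 - 1 / 10 ^ 6) * K ^ 10 - 1) + 1 / K ^ 19) ^ 2 * log K
        ≤ 1 / 12 := by
  have hK0 : (0 : ℝ) < K := by linarith
  have hK1 : (1 : ℝ) ≤ K := by linarith
  have hK10 : (0 : ℝ) < K ^ 10 := by positivity
  have h1610 : (16 : ℝ) ^ 10 ≤ K ^ 10 := pow_le_pow_left₀ (by norm_num) hK 10
  have hρK : 0 ≤ ρ ^ 2 * K ^ 10 := by positivity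
  have hlo : 200 * ε / K ^ 20 ≤ ρ ^ 2 := by
    rw [hlat, div_le_iff₀ (by positivity)]
    nlinarith only [mul_nonneg hρK (sub_nonneg.2 h1610), hρK]
  have hhi : K ^ 10 * ρ ^ 2 ≤ 2 * ε := by rw [hlat]; linarith only [hρK]
  have hk : ε = ((1 : ℕ) : ℝ) * K ^ 10 * ρ ^ 2 := by rw [hlat, Nat.cast_one, one_mul]
  have hρε : ρ ^ 2 ≤ ε := by
    rw [hlat]; nlinarith only [mul_nonneg (sq_nonneg ρ) (sub_nonneg.2 h1610), sq_nonneg ρ]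
  have hden : 3 / 2 * K ^ 10 ≤ (25 / 16 - 1 / 10 ^ 6) * K ^ 10 - 1 := by
    linarith only [h1610]
  have hden0 : 0 < (25 / 16 - 1 / 10 ^ 6) * K ^ 10 - 1 := by linarith only [hden, hK10]
  have hδ0 : 0 ≤ π / ((25 / 16 - 1 / 10 ^ 6) * K ^ 10 - 1) + 1 / K ^ 19 :=
    add_nonneg (div_nonneg pi_pos.le hden0.le) (by positivity)
  have hδ4 : π / ((25 / 16 - 1 / 10 ^ 6) * K ^ 10 - 1) + 1 / K ^ 19 ≤ 4 / K ^ 10 := by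
    have e1 : π / ((25 / 16 - 1 / 10 ^ 6) * K ^ 10 - 1) ≤ π / (3 / 2 * K ^ 10) :=
      div_le_div_of_nonneg_left pi_pos.le (by positivity) hden
    have e2 : π / (3 / 2 * K ^ 10) ≤ 3 / K ^ 10 := by
      rw [div_le_div_iff₀ (by positivity) hK10]
      nlinarith only [pi_le_four, hK10]
    have e3 : 1 / K ^ 19 ≤ 1 / K ^ 10 :=
      div_le_div_of_nonneg_left zero_le_one hK10 (pow_le_pow_right₀ hK1 (by norm_num))
    have e4 : (3 : ℝ) / K ^ 10 + 1 / K ^ 10 = 4 / K ^ 10 := by ring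
    linarith only [e1, e2, e3, e4]
  have hlogK : 0 ≤ log K := log_nonneg hK1
  have hpinterm : 1500 * (π / ((25 / 16 - 1 / 10 ^ 6) * K ^ 10 - 1) + 1 / K ^ 19) ^ 2 * log K
      ≤ 1 / 12 := by
    have e1 : (π / ((25 / 16 - 1 / 10 ^ 6) * K ^ 10 - 1) + 1 / K ^ 19) ^ 2 ≤ (4 / K ^ 10) ^ 2 :=
      pow_le_pow_left₀ hδ0 hδ4 2
    have e2 : log K ≤ K := (log_le_sub_one_of_pos hK0).trans (by linarith)
    have e3 : 1500 * (π / ((25 / 16 - 1 / 10 ^ 6) * K ^ 10 - 1) + 1 / K ^ 19) ^ 2 * log K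
        ≤ 1500 * (4 / K ^ 10) ^ 2 * K :=
      mul_le_mul (mul_le_mul_of_nonneg_left e1 (by norm_num)) e2 hlogK (by positivity)
    refine e3.trans ?_
    rw [show 1500 * ((4 : ℝ) / K ^ 10) ^ 2 * K = 24000 * K / (K ^ 10 * K ^ 10) by
        field_simp; ring, div_le_div_iff₀ (by positivity) (by norm_num)]
    have h19 : (16 : ℝ) ^ 19 ≤ K ^ 19 := pow_le_pow_left₀ (by norm_num) hK 19
    nlinarith only [mul_le_mul_of_nonneg_left h19 hK0.le, hK0]
  exact ⟨hlo, hhi, hk, hρε, hδ0, hδ4, hpinterm⟩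

/-! ## §288b The swing-priced ceiling at the pin -/

/-- §288b THE SWING-PRICED CEILING AT THE PIN (headline member from `delayInit` with a trigger
primitive `C`, `K ≥ 16`, `0 < ε`, `ε² ≤ 1/(6K²⁰)`, `0 < ρ`, unit lattice `ε = K¹⁰ρ²`). For a
pulse on `[r, T']`, `0 ≤ r ≤ T'`, igniting in normal form `b(r) = θε`, `5/4 ≤ θ ≤ 3/2`,
`c(r) = ρ²/K⁹`, `P(r) = d(r)² + ã(r)² ≤ 1/50`, of duration `≤ 242/K⁹` and `≤ 241 log K/K¹⁰`,
with `c > 0` on it, exit `b(T') = -θ₁ε`, `θ₁ ≥ (31/32)θ`, and exit phase at the part-52 pin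
`|(C(T') - C(r))/ρ² - π| ≤ δ₀`:
`ã(T') ≤ ã(r) + (1.57a(r)² + 3.33(|d(r)| + d(r)²) + 1/3 + 520 log K·d(r)²)/K⁹`.
Part 105 §287 with the kept ring from part 53 (entry radius `θ²ε² + ρ⁴/K¹⁸ ≤ 4ε²`),
`a(r) ≠ 0` from the sphere (`a(r)² ≥ 1 - 10⁻⁶ - 1/50`), and `1500δ₀² log K ≤ 1/12` (§288a).
[derived: part 105 §287, part 53 §157, §288a] -/
theorem knob_pulse_ceiling_swing_pin
    (hX : ∀ t, HasDerivAt X (RotorKnob.rotorCircuit K (K ^ 10) ε ρ (X t)) t)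
    (h0 : X 0 = delayInit) (hC : ∀ t, HasDerivAt C (X t 2) t) (hK : 16 ≤ K) (hε : 0 < ε)
    (hεK : ε ^ 2 ≤ 1 / (6 * K ^ 20)) (hρ : 0 < ρ) (hlat : ε = K ^ 10 * ρ ^ 2)
    {r T' θ θ₁ : ℝ} (hr : 0 ≤ r) (hrT : r ≤ T') (hτ : T' - r ≤ 242 / K ^ 9)
    (hτ' : T' - r ≤ 241 * log K / K ^ 10) (hθ1 : 5 / 4 ≤ θ) (hθ2 : θ ≤ 3 / 2)
    (hbr : X r 1 = θ * ε) (hcr : X r 2 = ρ ^ 2 / K ^ 9) (hPr : X r 3 ^ 2 + X r 4 ^ 2 ≤ 1 / 50)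
    (hpos : ∀ t ∈ Icc r T', 0 < X t 2) (hbT : X T' 1 = -(θ₁ * ε)) (hθ₁ : 31 / 32 * θ ≤ θ₁)
    (hpin : |(C T' - C r) / ρ ^ 2 - π|
      ≤ π / ((25 / 16 - 1 / 10 ^ 6) * K ^ 10 - 1) + 1 / K ^ 19) :
    X T' 4 ≤ X r 4 + (157 / 100 * X r 0 ^ 2 + 333 / 100 * (|X r 3| + X r 3 ^ 2) + 1 / 3
      + 520 * log K * X r 3 ^ 2) / K ^ 9 := by
  have hK1 : (1 : ℝ) ≤ K := by linarith
  have hK9 : (0 : ℝ) < K ^ 9 := by positivity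
  have hK10 : (0 : ℝ) < K ^ 10 := by positivity
  obtain ⟨-, -, -, hρε, hδ0, -, hpinterm⟩ := unit_lattice_numerics hK hlat
  obtain ⟨δ, hδ_def⟩ :
      ∃ δ : ℝ, δ = π / ((25 / 16 - 1 / 10 ^ 6) * K ^ 10 - 1) + 1 / K ^ 19 := ⟨_, rfl⟩
  simp only [← hδ_def] at hpin hδ0 hpinterm
  -- (1) the kept ring (part 53 §157) from the entry radius `b(r)² + c(r)² ≤ 4ε²`
  have hc1 : ρ ^ 2 / K ^ 9 ≤ ε := (div_le_self (sq_nonneg ρ) (one_le_pow₀ hK1)).trans hρε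
  have hRs : X r 1 ^ 2 + X r 2 ^ 2 ≤ 4 * ε ^ 2 := by
    rw [hbr, hcr]
    have h1 : (θ * ε) ^ 2 ≤ (3 / 2 * ε) ^ 2 :=
      pow_le_pow_left₀ (mul_nonneg (by linarith only [hθ1]) hε.le)
        (by nlinarith only [hθ2, hε]) 2
    have h2 : (ρ ^ 2 / K ^ 9) ^ 2 ≤ ε ^ 2 := pow_le_pow_left₀ (by positivity) hc1 2
    nlinarith only [h1, h2, sq_nonneg ε]
  have hkept := knob_radius_kept_free hX h0 hK10.le hε hρε hK hr hτ hRs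
  -- (2) the exit clock `b(T') ≤ -(31/32)θε`
  have hbT' : X T' 1 ≤ -(31 / 32 * θ * ε) := by rw [hbT]; nlinarith only [hθ₁, hε]
  -- (3) `a(r) ≠ 0`: the sphere minus `b(r)² + c(r)² ≤ 10⁻⁶` minus `P(r) ≤ 1/50`
  have ha : X r 0 ≠ 0 := by
    have hbc : X r 1 ^ 2 + X r 2 ^ 2 ≤ 1 / 10 ^ 6 := by
      have hK20 : (16 : ℝ) ^ 20 ≤ K ^ 20 := pow_le_pow_left₀ (by norm_num) hK 20
      have e2 : ε ^ 2 ≤ 1 / (6 * 16 ^ 20) :=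
        hεK.trans (div_le_div_of_nonneg_left (by norm_num) (by positivity)
          (by linarith only [hK20]))
      linarith only [hRs, e2]
    intro ha0
    have hE := RotorKnob.traj_sum_sq_eq_one hX h0 r
    have h00 : X r 0 ^ 2 = 0 := by rw [ha0]; ring
    linarith only [hE, h00, hbc, hPr]
  -- (4) part 105 §287 at the pin; the pin term is absorbed (`1/4 + 1500δ₀²log K ≤ 1/3`)
  have hceil := knob_pulse_ceiling_swing hX h0 hC hK hε hρ hlat hr hrT hτ hτ' hθ1 hθ2 ha hbr
    hcr hkept hpos hbT' hpin
  have e : (157 / 100 * X r 0 ^ 2 + 333 / 100 * (|X r 3| + X r 3 ^ 2) + 1 / 4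
      + (520 * X r 3 ^ 2 + 1500 * δ ^ 2) * log K) / K ^ 9
      ≤ (157 / 100 * X r 0 ^ 2 + 333 / 100 * (|X r 3| + X r 3 ^ 2) + 1 / 3
      + 520 * log K * X r 3 ^ 2) / K ^ 9 :=
    div_le_div_of_nonneg_right (by nlinarith only [hpinterm]) hK9.le
  linarith only [hceil, e]

/-- §288c THE SWING-PRICED CEILING, LADDER FORM (same setting as §288b). With the exit clock
in the shape part 90 `knob_pulse_debit` exports it, `θ - 242 log K/K¹⁰ ≤ θ₁` (so
`θ₁ ≥ (31/32)θ`, since `242 log K/K¹⁰ ≤ 242/K⁹ ≤ 242/16⁹`), a drift bound `|d(r)| ≤ D` and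
`a(r)² ≤ 1` (the sphere): `ã(T') ≤ ã(r) + U/K⁹` for every
`U ≥ 1.57 + 1/3 + 3.33(D + D²) + 520 log K·D²` — the hypothesis `hU` of the `k = 1` ladder
(part 107) in place of part 97's `7/2 + k²/3 + (2 log k + 520 log K)D² ≤ U`.
[derived: §288b] -/
theorem knob_pulse_ceiling_swing_ladder
    (hX : ∀ t, HasDerivAt X (RotorKnob.rotorCircuit K (K ^ 10) ε ρ (X t)) t)
    (h0 : X 0 = delayInit) (hC : ∀ t, HasDerivAt C (X t 2) t) (hK : 16 ≤ K) (hε : 0 < ε)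
    (hεK : ε ^ 2 ≤ 1 / (6 * K ^ 20)) (hρ : 0 < ρ) (hlat : ε = K ^ 10 * ρ ^ 2)
    {r T' θ θ₁ D U : ℝ} (hr : 0 ≤ r) (hrT : r ≤ T') (hτ : T' - r ≤ 242 / K ^ 9)
    (hτ' : T' - r ≤ 241 * log K / K ^ 10) (hθ1 : 5 / 4 ≤ θ) (hθ2 : θ ≤ 3 / 2)
    (hbr : X r 1 = θ * ε) (hcr : X r 2 = ρ ^ 2 / K ^ 9) (hPr : X r 3 ^ 2 + X r 4 ^ 2 ≤ 1 / 50)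
    (hpos : ∀ t ∈ Icc r T', 0 < X t 2) (hbT : X T' 1 = -(θ₁ * ε))
    (hθ₁ : θ - 242 * log K / K ^ 10 ≤ θ₁)
    (hpin : |(C T' - C r) / ρ ^ 2 - π|
      ≤ π / ((25 / 16 - 1 / 10 ^ 6) * K ^ 10 - 1) + 1 / K ^ 19)
    (hdD : |X r 3| ≤ D)
    (hU : 157 / 100 + 1 / 3 + 333 / 100 * (D + D ^ 2) + 520 * log K * D ^ 2 ≤ U) :
    X T' 4 ≤ X r 4 + U / K ^ 9 := by
  have hK0 : (0 : ℝ) < K := by linarith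
  have hK1 : (1 : ℝ) ≤ K := by linarith
  have hK9 : (0 : ℝ) < K ^ 9 := by positivity
  have hK10 : (0 : ℝ) < K ^ 10 := by positivity
  -- `242 log K/K¹⁰ ≤ 242/K⁹ ≤ 242/16⁹ ≤ θ/32`
  have hθ₁' : 31 / 32 * θ ≤ θ₁ := by
    have hlog : log K ≤ K := (log_le_sub_one_of_pos hK0).trans (by linarith)
    have h1 : 242 * log K / K ^ 10 ≤ 242 / K ^ 9 := by
      rw [div_le_div_iff₀ hK10 hK9]
      have : 242 * log K * K ^ 9 ≤ 242 * K * K ^ 9 :=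
        mul_le_mul_of_nonneg_right (by linarith only [hlog]) hK9.le
      have e : (242 : ℝ) * K * K ^ 9 = 242 * K ^ 10 := by ring
      linarith only [this, e]
    have h169 : (16 : ℝ) ^ 9 ≤ K ^ 9 := pow_le_pow_left₀ (by norm_num) hK 9
    have h2 : (242 : ℝ) / K ^ 9 ≤ 242 / 16 ^ 9 :=
      div_le_div_of_nonneg_left (by norm_num) (by norm_num) h169
    norm_num at h2
    linarith only [hθ₁, h1, h2, hθ1]
  have hceil := knob_pulse_ceiling_swing_pin hX h0 hC hK hε hεK hρ hlat hr hrT hτ hτ' hθ1 hθ2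
    hbr hcr hPr hpos hbT hθ₁' hpin
  -- `a(r)² ≤ 1` (the sphere) and `|d(r)| ≤ D`, `d(r)² ≤ D²`
  have ha1 : X r 0 ^ 2 ≤ 1 := by
    have hE := RotorKnob.traj_sum_sq_eq_one hX h0 r
    nlinarith only [hE, sq_nonneg (X r 1), sq_nonneg (X r 2), sq_nonneg (X r 3),
      sq_nonneg (X r 4)]
  have hd2D : X r 3 ^ 2 ≤ D ^ 2 := by
    have := pow_le_pow_left₀ (abs_nonneg _) hdD 2
    rwa [sq_abs] at this
  have hlogK : 0 ≤ log K := log_nonneg hK1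
  have hUr : 157 / 100 * X r 0 ^ 2 + 333 / 100 * (|X r 3| + X r 3 ^ 2) + 1 / 3
      + 520 * log K * X r 3 ^ 2 ≤ U := by
    have := mul_le_mul_of_nonneg_left hd2D (mul_nonneg (by norm_num : (0 : ℝ) ≤ 520) hlogK)
    linarith only [this, hU, ha1, hdD, hd2D]
  linarith only [hceil, div_le_div_of_nonneg_right hUr hK9.le]

/-! ## §288 The two-sided rung at `k = 1` with the swing price -/

/-- §288 **THE TWO-SIDED RUNG AT `k = 1` WITH THE SWING PRICE** (headline member from
`delayInit` with a trigger primitive `C`, `K ≥ 16`, `0 < ε`, `ε² ≤ 1/(6K²⁰)`, `0 < ρ`, unit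
lattice `ε = K¹⁰ρ²`). IF the knob ignites in normal form at `r ≥ 0` — `b(r) = θε`,
`5/4 ≤ θ ≤ 3/2`, `c(r) = ρ²/K⁹` — with `P(r) = d(r)² + ã(r)² ≤ 1/50`, THEN there is a pulse
exit `T'`, `r < T' ≤ r + 242/K⁹`, `T' - r ≤ 241 log K/K¹⁰`, with
`ã(r) + 1/K⁹ ≤ ã(T') ≤ ã(r) + (1.57a(r)² + 3.33(|d(r)| + d(r)²) + 1/3 + 520 log K·d(r)²)/K⁹`.
Part 76 §227 at `k = 1` (floor: its proof verbatim — fine pulse of part 65, kept ring and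
pin of part 52, leak law of part 71 §217, entry carrier `a² + d² ≥ 49/50 - 10⁻⁶`) with the
ceiling of §288b in place of part 75 §226.
[derived: part 65 §203, part 52 §153/§154, part 71 §217, §288a, §288b] -/
theorem knob_rung_swing
    (hX : ∀ t, HasDerivAt X (RotorKnob.rotorCircuit K (K ^ 10) ε ρ (X t)) t)
    (h0 : X 0 = delayInit) (hC : ∀ t, HasDerivAt C (X t 2) t) (hK : 16 ≤ K) (hε : 0 < ε)
    (hεK : ε ^ 2 ≤ 1 / (6 * K ^ 20)) (hρ : 0 < ρ) (hlat : ε = K ^ 10 * ρ ^ 2) {r θ : ℝ}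
    (hr : 0 ≤ r) (hθ1 : 5 / 4 ≤ θ) (hθ2 : θ ≤ 3 / 2) (hbr : X r 1 = θ * ε)
    (hcr : X r 2 = ρ ^ 2 / K ^ 9) (hPr : X r 3 ^ 2 + X r 4 ^ 2 ≤ 1 / 50) :
    ∃ T' : ℝ, r < T' ∧ T' - r ≤ 242 / K ^ 9 ∧ T' - r ≤ 241 * log K / K ^ 10 ∧
      X r 4 + 1 / K ^ 9 ≤ X T' 4 ∧
      X T' 4 ≤ X r 4 + (157 / 100 * X r 0 ^ 2 + 333 / 100 * (|X r 3| + X r 3 ^ 2) + 1 / 3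
        + 520 * log K * X r 3 ^ 2) / K ^ 9 := by
  have hK0 : (0 : ℝ) < K := by linarith
  obtain ⟨hlo, hhi, hk, -, -, -, -⟩ := unit_lattice_numerics hK hlat
  obtain ⟨-, -, -, hδ0, hδ, h243⟩ := leak_numerics hK hε hρ hlo 1 hk
  -- (1) the fine pulse (part 65 §203)
  obtain ⟨T', θ₁, hrT, hτ, hτf, hcpos, hcT1, -, -, hbT, hθ₁lo, -, hkept, hgrow⟩ :=
    knob_pulse_exit_fine hX h0 hK hε hρ hlo hhi hr hθ1 hθ2 hbr hcr
  have hθ₁1 : 1 ≤ θ₁ := by linarith only [hθ₁lo, hθ1, h243]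
  -- (2) the ring and the pin (part 52 §153/§154), uniform `ν₂ = 25/16 - 10⁻⁶`
  have hbr' : 5 / 4 * ε ≤ X r 1 := by rw [hbr]; nlinarith only [hθ1, hε]
  have hring := kept_ring hε.le (by norm_num : (0 : ℝ) ≤ 5 / 4) hbr' hkept
  have hring' : ∀ t ∈ Icc r T', (25 / 16 - 1 / 10 ^ 6) * ε ^ 2 ≤ X t 1 ^ 2 + X t 2 ^ 2 := by
    intro t ht
    have := hring t ht
    linarith only [this]
  have hbT1 : X T' 1 ≤ -(1 * ε) := by rw [hbT]; nlinarith only [hθ₁1, hε]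
  obtain ⟨hpin, -, -, -, -⟩ := knob_pulse_step hX h0 hC hK hε hεK hρ hhi 1 hk hr
    hrT.le hτ (le_refl _) (le_refl _) (by norm_num) hcpos hcr.le hbr' hbT1 hcT1 hring' hgrow
  -- the same pin with `1·π` read as `π`, for §288b
  have hpin' : |(C T' - C r) / ρ ^ 2 - π|
      ≤ π / ((25 / 16 - 1 / 10 ^ 6) * K ^ 10 - 1) + 1 / K ^ 19 := by
    simpa only [Nat.cast_one, one_mul] using hpin
  obtain ⟨δ, hδ_def⟩ :
      ∃ δ : ℝ, δ = ((1 : ℕ) : ℝ) * π / ((25 / 16 - 1 / 10 ^ 6) * K ^ 10 - 1) + 1 / K ^ 19 :=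
    ⟨_, rfl⟩
  simp only [← hδ_def] at hδ0 hδ hpin
  -- (3) the entry radius `b(r)² + c(r)² ≤ (θ² + 10⁻⁶)ε²`
  have hK10 : (2 : ℝ) ^ 40 ≤ K ^ 10 := by
    calc (2 : ℝ) ^ 40 = 16 ^ 10 := by norm_num
      _ ≤ K ^ 10 := pow_le_pow_left₀ (by norm_num) hK 10
  have hK10pos : (0 : ℝ) < K ^ 10 := by positivity
  have hK9pos : (0 : ℝ) < K ^ 9 := by positivity
  have hρε : ρ ^ 2 ≤ 2 * ε / K ^ 10 := by
    rw [le_div_iff₀ hK10pos]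
    linarith only [hhi]
  have hc1 : ρ ^ 2 / K ^ 9 ≤ ε / 10 ^ 3 := by
    have e1 : ρ ^ 2 / K ^ 9 ≤ ρ ^ 2 :=
      div_le_self (by positivity) (one_le_pow₀ (by linarith only [hK]))
    have e3 : 2 * ε / K ^ 10 ≤ 2 * ε / 2 ^ 40 :=
      div_le_div_of_nonneg_left (by positivity) (by positivity) hK10
    have e4 : 2 * ε / 2 ^ 40 ≤ ε / 10 ^ 3 := by
      rw [div_le_div_iff₀ (by positivity) (by positivity)]
      linarith only [hε]
    linarith only [e1, hρε, e3, e4]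
  have hc2 : (ρ ^ 2 / K ^ 9) ^ 2 ≤ ε ^ 2 / 10 ^ 6 := by
    calc (ρ ^ 2 / K ^ 9) ^ 2 ≤ (ε / 10 ^ 3) ^ 2 := pow_le_pow_left₀ (by positivity) hc1 2
      _ = ε ^ 2 / 10 ^ 6 := by rw [div_pow]; norm_num
  have hbc : X r 1 ^ 2 + X r 2 ^ 2 ≤ (θ ^ 2 + 1 / 10 ^ 6) * ε ^ 2 := by
    rw [hbr, hcr]
    nlinarith only [hc2]
  -- (4) the leak law of part 71 §217
  have hleak := knob_pulse_leak hX h0 hC hK hε hεK hρ hhi 1 hk hr hrT.le hτ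
    (by linarith only [hθ1]) hbc hkept hpin
  -- (5) the entry carrier `a(r)² + d(r)² ≥ 49/50 - 10⁻⁶` and the numerics
  have hbc' : X r 1 ^ 2 + X r 2 ^ 2 ≤ 1 / 10 ^ 6 := by
    refine hbc.trans ?_
    have e1 : (θ ^ 2 + 1 / 10 ^ 6) * ε ^ 2 ≤ (9 / 4 + 1 / 10 ^ 6) * ε ^ 2 :=
      mul_le_mul_of_nonneg_right (by nlinarith only [hθ1, hθ2]) (sq_nonneg ε)
    have hK20 : (2 : ℝ) ^ 80 ≤ K ^ 20 := by
      calc (2 : ℝ) ^ 80 = 16 ^ 20 := by norm_num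
        _ ≤ K ^ 20 := pow_le_pow_left₀ (by norm_num) hK 20
    have e2 : ε ^ 2 ≤ 1 / (6 * 2 ^ 40) :=
      hεK.trans (div_le_div_of_nonneg_left (by norm_num) (by positivity)
        (by linarith only [hK20]))
    nlinarith only [e1, e2]
  have hA : 49 / 50 - 1 / 10 ^ 6 ≤ X r 0 ^ 2 + X r 3 ^ 2 := by
    have hE := RotorKnob.traj_sum_sq_eq_one hX h0 r
    nlinarith only [hE, hbc', hPr, sq_nonneg (X r 3)]
  have hnum : 1 / K ^ 9 ≤ ((X r 0 ^ 2 + X r 3 ^ 2) * π / 2 - δ - δ ^ 2) / ((θ + 1 / 500) * K ^ 9)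
      - 1 / (600 * K ^ 9) := by
    have hpos : 0 < (θ + 1 / 500) * K ^ 9 := by positivity
    have hAπ : (49 / 50 - 1 / 10 ^ 6) * 3.14 ≤ (X r 0 ^ 2 + X r 3 ^ 2) * π :=
      mul_le_mul hA Real.pi_gt_d2.le (by norm_num) (by positivity)
    have hδ2 : δ ^ 2 ≤ δ * (1 / 80) := by
      rw [sq]
      exact mul_le_mul_of_nonneg_left hδ hδ0
    have key : (1 + 1 / 600) * (θ + 1 / 500)
        ≤ (X r 0 ^ 2 + X r 3 ^ 2) * π / 2 - δ - δ ^ 2 := by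
      nlinarith only [hAπ, hδ2, hδ, hδ0, hθ2, hθ1]
    have e1 : (1 + 1 / 600) / K ^ 9
        = (1 + 1 / 600) * (θ + 1 / 500) / ((θ + 1 / 500) * K ^ 9) := by
      rw [div_eq_div_iff hK9pos.ne' hpos.ne']
      ring
    have e2 := div_le_div_of_nonneg_right key hpos.le
    rw [← e1] at e2
    have e3 : 1 / K ^ 9 = (1 + 1 / 600) / K ^ 9 - 1 / (600 * K ^ 9) := by
      rw [eq_sub_iff_add_eq, div_add_div _ _ hK9pos.ne' (by positivity),
        div_eq_div_iff (by positivity) hK9pos.ne']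
      ring
    rw [e3]
    linarith only [e2]
  -- (6) the swing-priced ceiling of §288b at the same pin
  have hθ₁' : 31 / 32 * θ ≤ θ₁ := by linarith only [hθ₁lo, hθ1, h243]
  have hceil := knob_pulse_ceiling_swing_pin hX h0 hC hK hε hεK hρ hlat hr hrT.le hτ hτf hθ1
    hθ2 hbr hcr hPr hcpos hbT hθ₁' hpin'
  exact ⟨T', hrT, hτ, hτf, by linarith only [hleak, hnum], hceil⟩

end Summit.NavierStokesRegularity.FluidComputer.GateBudget
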